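import Literature.IUT.HodgeArakelov.Prop13ToyModel

/-!
# [IUTchII] Prop. 1.3 (iii) sub-nodes r1, r2, r3, r4a, r4b AND (iii), (i)(ii) themselves: the universal closures over
# ALL binders DECIDED at a closed datum (rows F-2779, F-2780, F-2781, F-2782, F-2783, F-0664, F-0420)

S. Mochizuki, *Inter-universal Teichmüller theory II*, §1, Proposition 1.3 (ii) p. 26 (the [AbsTopIII] cyclotomes with
"the natural isomorphism `μ_Ẑ(G_k) ⥲ μ_Ẑ(Π_X)` of [AbsTopIII], Corollary 1.10, (c)", "the natural isomorphism
`μ_Ẑ(M_TM) ⥲ μ_Ẑ(G)` of [AbsTopIII], Remark 3.2.1" and the two correspondences of notation) and (iii) with its proof,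
p. 27 l. 1–7 ("both isomorphisms `(*mono-Θ)`, `(*bs-Gal)` coincide with the conventional identification between the
cyclotomes involved that arises from conventional scheme theory"), kurims manuscript (Dec. 2020). Record-only under
the claim key `Mochizuki2012` (D-0012, disputed). PROOF-ONLY companion (abc-iut cell, block F, seat abc-iut-f-185,
F-TRANCHES tranche 185) of `Prop13ToyModel.lean` (the closed toy datum), of abc-iut-w5-d064's sub-DAG statements
`MonoThetaProp13Sub.lean` (p413560: binder `κ : ConventionalCyclotomes Z B ν`, sub-nodes r1–r4) and of
abc-iut-w5-d076's `Prop13SubExample32UniversalClosures.lean` (p430842: r4a/r4b characterised, re-gauge lemmas,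
`∀ κ ↔ IsEmpty ∨ Aut ν = 1`). No definition, nothing restated.

WHAT IS DECIDED (FACT-LIST rule R5: a parametrised row is admissible AT NAMED INSTANCES only; its universal closure
is recorded refuted by a kernel `¬ ∀`):
* `not_forall_corrMuNConventional` (F-2782, r4a) and `not_forall_corrIntSConventional` (F-2783, r4b) — the
  closures over ALL binders `S F E Z B ν κ` are FALSE: at the closed toy datum of `Prop13ToyModel` re-gauge the
  tautological `κ := ofBsGal` (where r2–r4 hold, w5-d064 `subnodes_ofBsGal`) by the inversion of `μ_N(S) ≅ μ_3`
  (w5-d076's `not_corr…_regauge`). This removes the `IsEmpty`/rigid-`ν` escape of p430842's `forall_…_iff`: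
  the binder type IS inhabited and `ν = μ_3` HAS a non-identity automorphism at a closed datum. Instance forms:
  `Prop13Sub.corrMuNConventional_ofBsGal`, `Prop13Sub.corrIntSConventional_ofBsGal` (p430842).
* `not_cor110cNatural_regauge`, `not_rmk321Natural_regauge` (the r2/r3 companions of w5-d076's lemmas) and
  `not_forall_cor110cNatural` (F-2780), `not_forall_rmk321Natural` (F-2781) — the same for the two INSIDE-cone
  sub-nodes; instance forms `Prop13Sub.subnodes_ofBsGal`.
* `monoThetaConventional_independent` (F-2779, r1) — r1 holds at the closed toy datum with the tautological `κ` and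
  its closure fails (w5-d064: at `κ := ofBsGal`, r1 IS (iii));
* `prop13_iii_independent` (F-0664) — `Prop13_iii` HOLDS at one closed datum and FAILS at another over the same
  `(C, Z)`; `prop13_i_ii_independent` (F-0420) — `Prop13_i_ii` HOLDS for `𝒞 = Type` and FAILS for a one-object
  rigid `𝒞`, over the same mono-theta environment.

READING. Every one of these typed clauses is a CONDITION ON DATA which the interfaces do not carry: r2/r3/r4 and
(iii) are supplied only by PINNING the binder `κ` / the [AbsTopIII] data to "conventional scheme theory" ([EtTh] §1,
[AbsTopIII] Cor. 1.10 (c), Rmk. 3.2.1 — owners L2/L4; GAP-LEDGER G-w4d042-1), (i)(ii) by `𝒞` BEING the tempered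
Frobenioid ([EtTh] §5) — exactly the appeals of the printed statement and proof. A refuted universal closure says the
typed row is a hypothesis on data, NOT that anything in print is false. HONEST FRAMING: nothing here bears on
[IUTchIII] Cor. 3.12; no side taken; typed ≠ proved.
-/

noncomputable section

namespace Literature.IUT.HodgeArakelov

namespace Prop13Toy

/-! ## 1. Re-gauging the binder `κ` for the sub-nodes r2, r3 (companions of w5-d076's r4a/r4b lemmas) -/

section Regauge

variable {S : ThetaSetting.{0}} {F : TemperedFrobenioidData S} {E : EnvOfFrobenioid F}
  {Z : FrobenioidCyclotomes E} {B : BsGalData Z} {ν : Type} [Group ν]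

/-- **Re-gauging kills r2** (`Cor110cNatural`): composing the identification `κ.idG : μ_Ẑ(G_k) ⊗ ℤ/N ⥲ ν` with an
automorphism `φ ≠ 1` of the reference cyclotome destroys the clause. [claim: Mochizuki2012, status: disputed]
(IUTchII §1 Prop 1.3 (ii)/(iii), kurims pp.26–27) -/
theorem not_cor110cNatural_regauge (κ : Prop13Sub.ConventionalCyclotomes Z B ν) (hκ : Prop13Sub.Cor110cNatural κ)
    (φ : ν ≃* ν) (hφ : φ ≠ MulEquiv.refl ν) :
    ¬ Prop13Sub.Cor110cNatural { κ with idG := κ.idG.trans φ } := by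
  intro h
  apply hφ
  ext v
  obtain ⟨y, rfl⟩ := κ.idG.surjective v
  have h1 := h y
  have h2 := hκ y
  simp only [MulEquiv.trans_apply] at h1
  rw [MulEquiv.refl_apply]
  exact h1.symm.trans h2

/-- **Re-gauging kills r3** (`Rmk321Natural`): the same for the identification `κ.idMTM : μ_Ẑ(M_TM) ⊗ ℤ/N ⥲ ν`.
[claim: Mochizuki2012, status: disputed] (IUTchII §1 Prop 1.3 (ii)/(iii), kurims pp.26–27) -/
theorem not_rmk321Natural_regauge (κ : Prop13Sub.ConventionalCyclotomes Z B ν) (hκ : Prop13Sub.Rmk321Natural κ)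
    (φ : ν ≃* ν) (hφ : φ ≠ MulEquiv.refl ν) :
    ¬ Prop13Sub.Rmk321Natural { κ with idMTM := κ.idMTM.trans φ } := by
  intro h
  apply hφ
  ext v
  obtain ⟨y, rfl⟩ := κ.idMTM.surjective v
  have h1 := h y
  have h2 := hκ y
  simp only [MulEquiv.trans_apply] at h1
  rw [MulEquiv.refl_apply]
  exact h1.symm.trans h2

end Regauge

/-! ## 2. The universal closures over ALL binders, decided -/

/-- **F-2782, universal closure REFUTED in kernel** ([IUTchII] Prop. 1.3 (ii) p. 26, sub-node r4a «`μ_N(S)` corresponds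
to `μ_Ẑ(M_TM) ⊗ (ℤ/Nℤ)`» read as conventional under the binder `κ`): NOT every conventional-identification datum over
every typed Prop. 1.2 (ii)/1.3 (i)(ii) datum satisfies r4a — at the CLOSED toy datum, re-gauge the tautological `κ`
(w5-d064's `ofBsGal`) by the inversion of `μ_N(S) ≅ μ_3` (w5-d076's `not_corrMuNConventional_regauge`). Complements
`Prop13Sub.forall_corrMuNConventional_iff` (p430842): its `IsEmpty`/rigid-`ν` escape does not occur. The INSTANCE form is
`Prop13Sub.corrMuNConventional_ofBsGal`. [claim: Mochizuki2012, status: disputed] (IUTchII §1 Prop 1.3 (ii), kurims p.26) -/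
theorem not_forall_corrMuNConventional :
    ¬ ∀ (S : ThetaSetting.{0}) (F : TemperedFrobenioidData S) (E : EnvOfFrobenioid F)
        (Z : FrobenioidCyclotomes E) (B : BsGalData Z) (ν : Type) [Group ν]
        (κ : Prop13Sub.ConventionalCyclotomes Z B ν),
        Literature.IUT.HodgeArakelov.Prop13Sub.CorrMuNConventional κ := fun h =>
  Prop13Sub.not_corrMuNConventional_regauge (Prop13Sub.ConventionalCyclotomes.ofBsGal bsGalData)
    (Prop13Sub.corrMuNConventional_ofBsGal bsGalData) muNFlip muNFlip_ne_refl
    (h setting frd envOfFrd cyc bsGalData _ _)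

/-- **F-2783, universal closure REFUTED in kernel** ([IUTchII] Prop. 1.3 (ii) p. 26, sub-node r4b «`(l·Δ_Θ)_S ⊗ (ℤ/Nℤ)`
corresponds to `μ_Ẑ(Π_X) ⊗ (ℤ/Nℤ)`» read as conventional under `κ`): at the closed toy datum, re-gauge `κ.idIntS` by the
same inversion (w5-d076's `not_corrIntSConventional_regauge`). The INSTANCE form is `Prop13Sub.corrIntSConventional_ofBsGal`.
[claim: Mochizuki2012, status: disputed] (IUTchII §1 Prop 1.3 (ii), kurims p.26) -/
theorem not_forall_corrIntSConventional :
    ¬ ∀ (S : ThetaSetting.{0}) (F : TemperedFrobenioidData S) (E : EnvOfFrobenioid F)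
        (Z : FrobenioidCyclotomes E) (B : BsGalData Z) (ν : Type) [Group ν]
        (κ : Prop13Sub.ConventionalCyclotomes Z B ν),
        Literature.IUT.HodgeArakelov.Prop13Sub.CorrIntSConventional κ := fun h =>
  Prop13Sub.not_corrIntSConventional_regauge (Prop13Sub.ConventionalCyclotomes.ofBsGal bsGalData)
    (Prop13Sub.corrIntSConventional_ofBsGal bsGalData) muNFlip muNFlip_ne_refl
    (h setting frd envOfFrd cyc bsGalData _ _)

/-- **F-2780 (`Cor110cNatural`, sub-node r2), universal closure REFUTED in kernel** at the closed toy datum (re-gauge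
`κ.idG`); instance form: w5-d064's `Prop13Sub.subnodes_ofBsGal`, first conjunct. (An INSIDE-cone row: this settles only
that the typed clause is a condition on `κ`, to be supplied by pinning `κ` to [AbsTopIII] Cor. 1.10 (c) — GAP-LEDGER
G-w4d042-1 — not by the interfaces.) [claim: Mochizuki2012, status: disputed] (IUTchII §1 Prop 1.3 (ii), kurims p.26) -/
theorem not_forall_cor110cNatural :
    ¬ ∀ (S : ThetaSetting.{0}) (F : TemperedFrobenioidData S) (E : EnvOfFrobenioid F)
        (Z : FrobenioidCyclotomes E) (B : BsGalData Z) (ν : Type) [Group ν]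
        (κ : Prop13Sub.ConventionalCyclotomes Z B ν),
        Literature.IUT.HodgeArakelov.Prop13Sub.Cor110cNatural κ := fun h =>
  not_cor110cNatural_regauge (Prop13Sub.ConventionalCyclotomes.ofBsGal bsGalData)
    (Prop13Sub.subnodes_ofBsGal bsGalData).1 muNFlip muNFlip_ne_refl
    (h setting frd envOfFrd cyc bsGalData _ _)

/-- **F-2781 (`Rmk321Natural`, sub-node r3), universal closure REFUTED in kernel** at the closed toy datum (re-gauge
`κ.idMTM`); instance form: `Prop13Sub.subnodes_ofBsGal`, second conjunct. (INSIDE-cone row; same reading as r2, with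
[AbsTopIII] Rmk. 3.2.1 / [FrdII] Thm. 2.4 (ii).) [claim: Mochizuki2012, status: disputed] (IUTchII §1 Prop 1.3 (ii), kurims p.26) -/
theorem not_forall_rmk321Natural :
    ¬ ∀ (S : ThetaSetting.{0}) (F : TemperedFrobenioidData S) (E : EnvOfFrobenioid F)
        (Z : FrobenioidCyclotomes E) (B : BsGalData Z) (ν : Type) [Group ν]
        (κ : Prop13Sub.ConventionalCyclotomes Z B ν),
        Literature.IUT.HodgeArakelov.Prop13Sub.Rmk321Natural κ := fun h =>
  not_rmk321Natural_regauge (Prop13Sub.ConventionalCyclotomes.ofBsGal bsGalData)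
    (Prop13Sub.subnodes_ofBsGal bsGalData).2.1 muNFlip muNFlip_ne_refl
    (h setting frd envOfFrd cyc bsGalData _ _)

/-- **F-0664 (`Prop13_iii`, node IUTchII:Prop1.3(iii)) is INDEPENDENT of the typed interfaces**: the printed
coincidence `(*mono-Θ) = (*bs-Gal)` HOLDS at one closed well-typed datum (`bsGalData`) and FAILS at another
(`bsGalDataFlip`) over the SAME Frobenioid-theoretic data `(C, Z)`. So the node can be closed only by an input that
PINS the [AbsTopIII] data of Prop. 1.3 (ii) — the residual `hgal`/`hρ` of GAP-LEDGER G-w4d042-1 — exactly as the printed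
proof's appeal to "conventional scheme theory" (p. 27 l. 5–7) says; nothing in print is claimed false.
[claim: Mochizuki2012, status: disputed] (IUTchII §1 Prop 1.3 (iii), kurims pp.26–27) -/
theorem prop13_iii_independent :
    (∃ (S : ThetaSetting.{0}) (F : TemperedFrobenioidData S) (E : EnvOfFrobenioid F)
        (C : CyclotomicRigidity E.recon) (Z : FrobenioidCyclotomes E) (B : BsGalData Z),
        Literature.IUT.HodgeArakelov.Prop13_iii C Z B) ∧
      ¬ ∀ (S : ThetaSetting.{0}) (F : TemperedFrobenioidData S) (E : EnvOfFrobenioid F)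
        (C : CyclotomicRigidity E.recon) (Z : FrobenioidCyclotomes E) (B : BsGalData Z),
        Literature.IUT.HodgeArakelov.Prop13_iii C Z B :=
  ⟨⟨setting, frd, envOfFrd, rigidity, cyc, bsGalData, prop13_iii_toy⟩,
    fun h => not_prop13_iii_flip (h setting frd envOfFrd rigidity cyc bsGalDataFlip)⟩

/-- **F-0420 (`Prop13_i_ii`, nodes IUTchII:Prop1.3(i)/(ii)) is INDEPENDENT of the typed interfaces**: the existence of
the Prop. 1.3 (i)(ii) data HOLDS for one closed Prop. 1.2 (ii) datum (`𝒞 = Type`) and FAILS for another (one rigid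
object) over the SAME mono-theta environment — it is a condition on `𝒞` (in print: `𝒞` IS the tempered Frobenioid of
`X̲̲_k`, [EtTh] §5), consistent with the CONDITIONAL status via w4-d042's `prop13_i_ii_of_cyclotome_data`.
[claim: Mochizuki2012, status: disputed] (IUTchII §1 Prop 1.3 (i)(ii), kurims p.26) -/
theorem prop13_i_ii_independent :
    (∃ (S : ThetaSetting.{0}) (F : TemperedFrobenioidData S) (E : EnvOfFrobenioid F),
        Literature.IUT.HodgeArakelov.Prop13_i_ii E) ∧
      ¬ ∀ (S : ThetaSetting.{0}) (F : TemperedFrobenioidData S) (E : EnvOfFrobenioid F),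
        Literature.IUT.HodgeArakelov.Prop13_i_ii E :=
  ⟨⟨setting, frd, envOfFrd, prop13_i_ii_envOfFrd⟩, fun h => not_prop13_i_ii_envOfFrdPoint (h setting frdPoint envOfFrdPoint)⟩

/-- **F-2779 (`MonoThetaConventional`, sub-node r1 «`(*mono-Θ)` coincides with the conventional identification»)
decided at closed data**: by w5-d064's `prop13_iii_iff_monoThetaConventional_ofBsGal` (at the tautological `κ`, r1 IS
(iii)), r1 HOLDS at the closed toy datum `(rigidity, ofBsGal bsGalData)` and its universal closure over ALL binders
FAILS (at `ofBsGal bsGalDataFlip`). INSIDE-cone row (conditional via `monoThetaConventional_of_rho`): a condition on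
`κ`/`ρ_{B_N}` ([EtTh] Prop. 5.5, Lem. 5.9 (v)), not a property of the interfaces. [claim: Mochizuki2012, status: disputed]
(IUTchII §1 Prop 1.3 (iii), kurims p.27 l.5–6) -/
theorem monoThetaConventional_independent :
    (∃ (S : ThetaSetting.{0}) (F : TemperedFrobenioidData S) (E : EnvOfFrobenioid F)
        (C : CyclotomicRigidity E.recon) (Z : FrobenioidCyclotomes E) (B : BsGalData Z),
        Literature.IUT.HodgeArakelov.Prop13Sub.MonoThetaConventional C
          (Prop13Sub.ConventionalCyclotomes.ofBsGal B)) ∧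
      ¬ ∀ (S : ThetaSetting.{0}) (F : TemperedFrobenioidData S) (E : EnvOfFrobenioid F)
        (C : CyclotomicRigidity E.recon) (Z : FrobenioidCyclotomes E) (B : BsGalData Z) (ν : Type) [Group ν]
        (κ : Prop13Sub.ConventionalCyclotomes Z B ν),
        Literature.IUT.HodgeArakelov.Prop13Sub.MonoThetaConventional C κ :=
  ⟨⟨setting, frd, envOfFrd, rigidity, cyc, bsGalData,
      (Prop13Sub.prop13_iii_iff_monoThetaConventional_ofBsGal (E := envOfFrd) (Z := cyc) rigidity bsGalData).mp
        prop13_iii_toy⟩,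
    fun h => not_prop13_iii_flip
      ((Prop13Sub.prop13_iii_iff_monoThetaConventional_ofBsGal (E := envOfFrd) (Z := cyc) rigidity bsGalDataFlip).mpr
        (h setting frd envOfFrd rigidity cyc bsGalDataFlip _
          (Prop13Sub.ConventionalCyclotomes.ofBsGal bsGalDataFlip)))⟩

end Prop13Toy

end Literature.IUT.HodgeArakelov
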